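import Summits.QuantumFields.YangMills.Theorems.BalabanUVNodesN21SourceTiltAtRecord
import Literature.MathematicalPhysics.QuantumFieldTheory.Balaban1983to89.T4GenFunConverse

/-!
# YM-DAG node N21 (= NE7c) — THE HISTORIES-ROAD JUNCTION AT THE LAWS OF RECORD: module 20e's ledgers ∕ road-I `ShellWeightBound` with its seven law∕tilt binders
# `γ0A γ0B γtA γtB hM htiltA htiltB` INSTANTIATED at the two runs' Boltzmann ∕ dressed laws of record (module 23), and E1 of the extraction clause read off (RESUM)

Track A of `YM-PLAN.md` (cell `pub-ymgap`, HUMAN RULING D-0062), node **N21**; R134 fan-out seat `pub-ymgap-dag-n21-d` (s2 = BY-NAME KNIT at the record), generation 6,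
module 23b.  THEOREMS ONLY: 0 `def`, 0 `sorry`, standard axioms; COUNT-NEUTRAL; `--supports` the K3‴ item `SpineGivenEndpointR13` (stmt-QuantumFields-19912) as a helper.
`N`- and `G`-generic, NO Theses import, NO `Node00.Record13` import (restate-immune).  Imports module 23 `BalabanUVNodesN21SourceTiltAtRecord` (`dressedLaw_sandwich_map`,
`dressedLaw_map_univ`, `isFiniteMeasure_boltzmannLaw`; brings module 20e `levelLedgers_histories_of_resummation` ∕ `shellWeightBound_histories_of_resummation` ∕
`sum_histWeight_eq_of_resummation` and `T4Continuum.FiniteEpsData.scheme`) and `T4GenFunConverse` (`schemeZ_pos`).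

THE POINT.  Run A of comparison `K` of the datum `D : FiniteEpsData F G` at bare couplings `g₀`, loop string `os`, is step `K₀ + K` of the Wilson scheme `D.scheme g₀`, run B is
step `K₀ + K + 1` (the steps of the K3‴ skeleton's `KeyedExtraction` E1 ∕ E2).  With NODE O's common space `Ω K` and embeddings `eA K : GaugeField (F.P (K₀+K)) 0 G → Ω K`,
`eB K : GaugeField (F.P (K₀+K+1)) 0 G → Ω K` (PARAMETERS — the lens's model A takes the disjoint union and `Sum.inl` ∕ `Sum.inr`), module 20e's junction is applied with
`γ0A K := (Boltzmann law of record at step K₀+K).map (eA K)`, `γtA K t := (dressed law of record at step K₀+K, source t).map (eA K)`, B likewise, `M := e^{l₀}`: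
`hM` is `Real.exp_pos`, `htiltA ∕ htiltB` are module 23's `dressedLaw_sandwich_map` (source bounded by ONE, `FiniteEpsData.abs_avgObs_le_one`), finiteness is module 23's
`isFiniteMeasure_boltzmannLaw`.  What the caller supplies instead: the datum's displayed proviso `D.AvgMeasurable` and `Measurable (eX K)`.
* `levelLedgers_histories_of_resummation_atRecord` — both runs' `LevelLedger`s at one selected admissible assignment, `D_j = (e^{l₀}∕(e^{l₀})⁻¹)·2ν̄∕((1−ρ_j)κ_j)`;
* `shellWeightBound_histories_of_resummation_atRecord` — road I's `ShellWeightBound l₀ T A B shA shB (K ↦ C′·ϑ^K)`, `C′ = 2((N₁+1)·ν̄·(e^{l₀}∕(e^{l₀})⁻¹·(4ν̄∕κ_min))·c₁·ϑ^{−N₁})`;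
* `schemeZ_eq_sum_histWeight_of_resummation` — under (RESUM) for run A at `(K, a, t)`, `schemeZ (D.scheme g₀) os (K₀ + K) t = Σ_{τ ∈ T K} A_K(t, τ)`: the extraction clause's
  E1 identity (`T4WeightBudget`'s `hZA` letter) for the history weights is a COROLLARY of (RESUM) at the record (20e `sum_histWeight_eq_of_resummation` + module 23
  `dressedLaw_map_univ`), not a separate input.

HONEST FRAMING (binding).  [folklore] bookkeeping: ONE application of a landed theorem per decl.  DISPLAYED after this file on the histories road: (RESUM) `Σ_τ histLaw^X_τ =
(dressed law of record).map (eX K)` at every admissible assignment = the SHAPE of NODE O's term object (its history measures `νX`, statistics `uX`, index data `T`, `small`,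
`C`, `lvl`, common space `Ω` and embeddings `eX` are PARAMETERS; nothing of Bałaban's expansion is typed here), N16's a.e. closeness by level, N20's window∕count, the admissible
box, the rate `ρ_j ≤ c₁ϑ^j`, `AvgMeasurable`.  (M1) for print's FIXED thresholds untouched; no inhabitant of any record class claimed (K0‴ open); NE7c is NOT PRINTED and NOT
PROVED; **N21 is NOT discharged**; K3‴ NOT claimed; typed 28∕28, discharged count untouched; one finite four-torus programme at fixed `ε` — NOT ℝ⁴, NOT infinite volume, NOT
OS, NOT a mass gap, NOT Clay.  No decl below carries a cite tag.
-/

set_option autoImplicit false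

noncomputable section

open scoped BigOperators ENNReal
open MeasureTheory Set

namespace Summit.QuantumFields.YangMills.Theorems.N21SourceTiltAtRecordLedgers

open Literature.MathematicalPhysics.QuantumFieldTheory.Balaban1983to89
open Literature.MathematicalPhysics.QuantumFieldTheory.Balaban1983to89.T4Continuum (T4Family ULoop FiniteEpsData)
open T4GenFunBounds (prodObs schemeZ)
open Missing (boltzmann)
open T4IndicatorShell (ShellWeightBound)
open T4ShellMeasureLevels (LevelLedger LiveWindow)
open Summit.QuantumFields.BalabanUV.T4Continuum.ShellMeasureRootCompositionHistories (histWeight histShell histPiece histLaw)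
open Summit.QuantumFields.YangMills.Theorems.N21SelectedThresholdsHistoriesResummation
  (levelLedgers_histories_of_resummation shellWeightBound_histories_of_resummation sum_histWeight_eq_of_resummation)
open Summit.QuantumFields.YangMills.Theorems.N21SourceTiltAtRecord (dressedLaw_sandwich_map dressedLaw_map_univ isFiniteMeasure_boltzmannLaw)

section Junction

variable {F : T4Family} {G : Type*} [GaugeGroup G] [MeasurableSpace G] [HaarData G] [RegularGaugeGroup G]
  (D : FiniteEpsData F G) (g₀ : ℕ → ℝ) (os : List (ULoop F)) (K₀ : ℕ)
  {Ω : ℕ → Type*} [∀ K, MeasurableSpace (Ω K)] {σ ι : Type*} [DecidableEq σ]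
  {T : ℕ → Finset ι} {C : ℕ → Finset σ} {small : ℕ → ι → Finset σ} {lvl : ℕ → σ → ℕ}
  {νA νB : ∀ K : ℕ, (ℕ → ℝ) → ℝ → ι → Measure (Ω K)} [∀ K a t τ, IsFiniteMeasure (νA K a t τ)] [∀ K a t τ, IsFiniteMeasure (νB K a t τ)]
  {eA : ∀ K : ℕ, GaugeField ((D.scheme g₀).P (K₀ + K)) 0 G → Ω K} {eB : ∀ K : ℕ, GaugeField ((D.scheme g₀).P (K₀ + K + 1)) 0 G → Ω K}
  {uA uB : ∀ K : ℕ, σ → Ω K → ℝ} {θ κ ρ Δ : ℕ → ℝ} {l₀ νbar : ℝ}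

omit [DecidableEq σ] in
/-- **E1 OF THE EXTRACTION CLAUSE IS A COROLLARY OF (RESUM) AT THE RECORD**: if run A's history laws at comparison `K` resum to the image of the dressed law of record at step
`K₀ + K` under a measurable embedding, then the history weights sum to the dressed partition function: `Σ_{τ ∈ T K} A_K(t, τ) = schemeZ (D.scheme g₀) os (K₀ + K) t` — the
K3‴ skeleton's `KeyedExtraction` E1 identity (`T4WeightBudget`'s `hZA`) for the history letters (20e `sum_histWeight_eq_of_resummation` + `dressedLaw_map_univ`). [folklore] -/
theorem schemeZ_eq_sum_histWeight_of_resummation (hM : D.AvgMeasurable) (heA : ∀ K, Measurable (eA K))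
    (huA : ∀ K s, Measurable (uA K s)) (K : ℕ) (a : ℕ → ℝ) (t : ℝ)
    (hres : ∑ τ ∈ T K, histLaw (νA K a t τ) (small K τ) (uA K) (fun s => a (lvl K s)) =
      ((fieldMeasure ((D.scheme g₀).P (K₀ + K)) 0 G).withDensity (fun U => ENNReal.ofReal
        (Real.exp (t * prodObs (D.scheme g₀) (K₀ + K) os U) * boltzmann ((D.scheme g₀).P (K₀ + K)) ((D.scheme g₀).β (K₀ + K)) U))).map (eA K)) :
    schemeZ (D.scheme g₀) os (K₀ + K) t = ∑ τ ∈ T K, histWeight (νA K a t τ) (small K τ) (uA K) (fun s => a (lvl K s)) := by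
  rw [sum_histWeight_eq_of_resummation (T K) (νA K a t) (small K) (huA K) _ hres,
    dressedLaw_map_univ (D.scheme g₀) (K₀ + K) os (fun _ => sq_nonneg _) (fun K' C' => D.measurable_avgObs hM K' C') (fun K' C' U => D.abs_avgObs_le_one K' C' U) t (heA K),
    ENNReal.toReal_ofReal (T4GenFunConverse.schemeZ_pos (D.scheme g₀) (fun _ => sq_nonneg _) (fun K' C' => D.measurable_avgObs hM K' C')
      (fun K' C' U => D.abs_avgObs_le_one K' C' U) (K₀ + K) os t).le]

/-- **BOTH RUNS' HISTORY LEDGERS AT THE SAME SELECTED THRESHOLDS, FROM RESUMMATION AGAINST THE DRESSED LAWS OF RECORD** — module 20e's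
`levelLedgers_histories_of_resummation` with `γ0A K := (Boltzmann law of record at step K₀ + K).map (eA K)`, `γtA K t := (dressed law of record at step K₀ + K, source t).map (eA K)`,
`γ0B ∕ γtB` the same at step `K₀ + K + 1`, `M := e^{l₀}`: the binders `γ0A γ0B γtA γtB hM htiltA htiltB` are GONE (§2 `dressedLaw_sandwich_map`, finiteness §2), replaced by the
datum's proviso `AvgMeasurable` and the measurability of NODE O's embeddings `eA`, `eB` of the two runs' level-0 field spaces into its common space `Ω K`.  Displayed after this:
(RESUM) against the NAMED laws, N16's a.e. closeness by level, N20's count, the admissible box.  `D_j = (e^{l₀}∕(e^{l₀})⁻¹)·2ν̄∕((1−ρ_j)κ_j)`. [folklore] -/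
theorem levelLedgers_histories_of_resummation_atRecord (hM : D.AvgMeasurable) (heA : ∀ K, Measurable (eA K)) (heB : ∀ K, Measurable (eB K))
    (huA : ∀ K s, Measurable (uA K s)) (huB : ∀ K s, Measurable (uB K s))
    (hsmall : ∀ K, ∀ τ ∈ T K, small K τ ⊆ C K)
    (hθ : ∀ j, 0 < θ j) (hκ : ∀ j, 0 < κ j ∧ κ j ≤ 1) (hρ : ∀ j, 0 ≤ ρ j ∧ ρ j < 1)
    (hcount : ∀ K m, ((((C K).filter fun s => lvl K s = m).card : ℕ) : ℝ) ≤ νbar)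
    (hle : ∀ K, ∀ s ∈ C K, lvl K s ≤ K)
    (hΔ : ∀ j, Δ j ≤ ρ j * ((1 - κ j) * θ j))
    (hcloseA : ∀ (K : ℕ) (a : ℕ → ℝ), (∀ j, a j ∈ Icc ((1 - κ j) * θ j) (θ j)) → ∀ t, |t| ≤ l₀ → ∀ τ ∈ T K, ∀ s ∈ small K τ,
      ∀ᵐ ω ∂(νA K a t τ), |uA K s ω - uB K s ω| ≤ Δ (lvl K s))
    (hcloseB : ∀ (K : ℕ) (a : ℕ → ℝ), (∀ j, a j ∈ Icc ((1 - κ j) * θ j) (θ j)) → ∀ t, |t| ≤ l₀ → ∀ τ ∈ T K, ∀ s ∈ small K τ,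
      ∀ᵐ ω ∂(νB K a t τ), |uB K s ω - uA K s ω| ≤ Δ (lvl K s))
    (hresA : ∀ (K : ℕ) (a : ℕ → ℝ), (∀ j, a j ∈ Icc ((1 - κ j) * θ j) (θ j)) → ∀ t, |t| ≤ l₀ →
      ∑ τ ∈ T K, histLaw (νA K a t τ) (small K τ) (uA K) (fun s => a (lvl K s)) =
        ((fieldMeasure ((D.scheme g₀).P (K₀ + K)) 0 G).withDensity (fun U => ENNReal.ofReal
          (Real.exp (t * prodObs (D.scheme g₀) (K₀ + K) os U) * boltzmann ((D.scheme g₀).P (K₀ + K)) ((D.scheme g₀).β (K₀ + K)) U))).map (eA K))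
    (hresB : ∀ (K : ℕ) (a : ℕ → ℝ), (∀ j, a j ∈ Icc ((1 - κ j) * θ j) (θ j)) → ∀ t, |t| ≤ l₀ →
      ∑ τ ∈ T K, histLaw (νB K a t τ) (small K τ) (uB K) (fun s => a (lvl K s)) =
        ((fieldMeasure ((D.scheme g₀).P (K₀ + K + 1)) 0 G).withDensity (fun U => ENNReal.ofReal
          (Real.exp (t * prodObs (D.scheme g₀) (K₀ + K + 1) os U) * boltzmann ((D.scheme g₀).P (K₀ + K + 1)) ((D.scheme g₀).β (K₀ + K + 1)) U))).map (eB K)) :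
    ∃ a : ℕ → ℕ → ℝ, (∀ K j, a K j ∈ Icc ((1 - κ j) * θ j) (θ j)) ∧
      LevelLedger l₀ T (fun K t τ => histWeight (νA K (a K) t τ) (small K τ) (uA K) (fun s => a K (lvl K s)))
        (fun K t τ => histShell (νA K (a K) t τ) (small K τ) (uA K) (uB K) (fun s => a K (lvl K s))) C
        (fun K t s τ => histPiece (νA K (a K) t τ) (small K τ) (uA K) (uB K) (fun s => a K (lvl K s)) s) lvl
        (fun j => Real.exp l₀ / (Real.exp l₀)⁻¹ * (2 * νbar / ((1 - ρ j) * κ j))) ρ ∧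
      LevelLedger l₀ T (fun K t τ => histWeight (νB K (a K) t τ) (small K τ) (uB K) (fun s => a K (lvl K s)))
        (fun K t τ => histShell (νB K (a K) t τ) (small K τ) (uB K) (uA K) (fun s => a K (lvl K s))) C
        (fun K t s τ => histPiece (νB K (a K) t τ) (small K τ) (uB K) (uA K) (fun s => a K (lvl K s)) s) lvl
        (fun j => Real.exp l₀ / (Real.exp l₀)⁻¹ * (2 * νbar / ((1 - ρ j) * κ j))) ρ := by
  have hβ : ∀ K, 0 ≤ (D.scheme g₀).β K := fun _ => sq_nonneg _
  have hm : ∀ K C, Measurable ((D.scheme g₀).obs K C) := fun K C => D.measurable_avgObs hM K C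
  have h1 : ∀ K C U, |(D.scheme g₀).obs K C U| ≤ 1 := fun K C U => D.abs_avgObs_le_one K C U
  haveI hfinA : ∀ K, IsFiniteMeasure (((fieldMeasure ((D.scheme g₀).P (K₀ + K)) 0 G).withDensity
      (fun U => ENNReal.ofReal (boltzmann ((D.scheme g₀).P (K₀ + K)) ((D.scheme g₀).β (K₀ + K)) U))).map (eA K)) := fun K => by
    haveI := isFiniteMeasure_boltzmannLaw (D.scheme g₀) (K₀ + K) hβ
    exact Measure.isFiniteMeasure_map _ _
  haveI hfinB : ∀ K, IsFiniteMeasure (((fieldMeasure ((D.scheme g₀).P (K₀ + K + 1)) 0 G).withDensity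
      (fun U => ENNReal.ofReal (boltzmann ((D.scheme g₀).P (K₀ + K + 1)) ((D.scheme g₀).β (K₀ + K + 1)) U))).map (eB K)) := fun K => by
    haveI := isFiniteMeasure_boltzmannLaw (D.scheme g₀) (K₀ + K + 1) hβ
    exact Measure.isFiniteMeasure_map _ _
  exact levelLedgers_histories_of_resummation
    (γ0A := fun K => ((fieldMeasure ((D.scheme g₀).P (K₀ + K)) 0 G).withDensity
      (fun U => ENNReal.ofReal (boltzmann ((D.scheme g₀).P (K₀ + K)) ((D.scheme g₀).β (K₀ + K)) U))).map (eA K))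
    (γ0B := fun K => ((fieldMeasure ((D.scheme g₀).P (K₀ + K + 1)) 0 G).withDensity
      (fun U => ENNReal.ofReal (boltzmann ((D.scheme g₀).P (K₀ + K + 1)) ((D.scheme g₀).β (K₀ + K + 1)) U))).map (eB K))
    (γtA := fun K t => ((fieldMeasure ((D.scheme g₀).P (K₀ + K)) 0 G).withDensity (fun U => ENNReal.ofReal
      (Real.exp (t * prodObs (D.scheme g₀) (K₀ + K) os U) * boltzmann ((D.scheme g₀).P (K₀ + K)) ((D.scheme g₀).β (K₀ + K)) U))).map (eA K))
    (γtB := fun K t => ((fieldMeasure ((D.scheme g₀).P (K₀ + K + 1)) 0 G).withDensity (fun U => ENNReal.ofReal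
      (Real.exp (t * prodObs (D.scheme g₀) (K₀ + K + 1) os U) * boltzmann ((D.scheme g₀).P (K₀ + K + 1)) ((D.scheme g₀).β (K₀ + K + 1)) U))).map (eB K))
    (M := Real.exp l₀)
    huA huB hsmall hθ hκ hρ hcount hle (Real.exp_pos l₀) hΔ hcloseA hcloseB
    (fun K t ht => dressedLaw_sandwich_map (D.scheme g₀) (K₀ + K) os hm h1 ht (heA K))
    (fun K t ht => dressedLaw_sandwich_map (D.scheme g₀) (K₀ + K + 1) os hm h1 ht (heB K))
    hresA hresB

/-- **N21's ROAD I ON HISTORY FAMILIES AT SELECTED THRESHOLDS, RESUMMED AGAINST THE DRESSED LAWS OF RECORD** — module 20e's `shellWeightBound_histories_of_resummation` with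
the seven law∕tilt binders INSTANTIATED as in `levelLedgers_histories_of_resummation_atRecord` (`M = e^{l₀}`): for SOME assignment admissible at every level,
`ShellWeightBound l₀ T A B shA shB (K ↦ C′·ϑ^K)` for the two runs' history letters, `C′ = 2((N₁+1)·ν̄·(e^{l₀}∕(e^{l₀})⁻¹·(4ν̄∕κ_min))·c₁·ϑ^{−N₁})`.  Displayed: (RESUM) against
the NAMED laws of record, N16's closeness, N20's live window, the admissible box, the rate, `AvgMeasurable`. [folklore] -/
theorem shellWeightBound_histories_of_resummation_atRecord {N₁ : ℕ} {κmin c₁ ϑ : ℝ} (hM : D.AvgMeasurable)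
    (heA : ∀ K, Measurable (eA K)) (heB : ∀ K, Measurable (eB K))
    (huA : ∀ K s, Measurable (uA K s)) (huB : ∀ K s, Measurable (uB K s))
    (hsmall : ∀ K, ∀ τ ∈ T K, small K τ ⊆ C K)
    (hθ : ∀ j, 0 < θ j) (hκ : ∀ j, 0 < κ j ∧ κ j ≤ 1) (hρ : ∀ j, 0 ≤ ρ j ∧ ρ j < 1)
    (hwin : LiveWindow C lvl N₁ νbar)
    (hΔ : ∀ j, Δ j ≤ ρ j * ((1 - κ j) * θ j))
    (hcloseA : ∀ (K : ℕ) (a : ℕ → ℝ), (∀ j, a j ∈ Icc ((1 - κ j) * θ j) (θ j)) → ∀ t, |t| ≤ l₀ → ∀ τ ∈ T K, ∀ s ∈ small K τ,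
      ∀ᵐ ω ∂(νA K a t τ), |uA K s ω - uB K s ω| ≤ Δ (lvl K s))
    (hcloseB : ∀ (K : ℕ) (a : ℕ → ℝ), (∀ j, a j ∈ Icc ((1 - κ j) * θ j) (θ j)) → ∀ t, |t| ≤ l₀ → ∀ τ ∈ T K, ∀ s ∈ small K τ,
      ∀ᵐ ω ∂(νB K a t τ), |uB K s ω - uA K s ω| ≤ Δ (lvl K s))
    (hresA : ∀ (K : ℕ) (a : ℕ → ℝ), (∀ j, a j ∈ Icc ((1 - κ j) * θ j) (θ j)) → ∀ t, |t| ≤ l₀ →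
      ∑ τ ∈ T K, histLaw (νA K a t τ) (small K τ) (uA K) (fun s => a (lvl K s)) =
        ((fieldMeasure ((D.scheme g₀).P (K₀ + K)) 0 G).withDensity (fun U => ENNReal.ofReal
          (Real.exp (t * prodObs (D.scheme g₀) (K₀ + K) os U) * boltzmann ((D.scheme g₀).P (K₀ + K)) ((D.scheme g₀).β (K₀ + K)) U))).map (eA K))
    (hresB : ∀ (K : ℕ) (a : ℕ → ℝ), (∀ j, a j ∈ Icc ((1 - κ j) * θ j) (θ j)) → ∀ t, |t| ≤ l₀ →
      ∑ τ ∈ T K, histLaw (νB K a t τ) (small K τ) (uB K) (fun s => a (lvl K s)) =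
        ((fieldMeasure ((D.scheme g₀).P (K₀ + K + 1)) 0 G).withDensity (fun U => ENNReal.ofReal
          (Real.exp (t * prodObs (D.scheme g₀) (K₀ + K + 1) os U) * boltzmann ((D.scheme g₀).P (K₀ + K + 1)) ((D.scheme g₀).β (K₀ + K + 1)) U))).map (eB K))
    (hκmin : 0 < κmin) (hκminle : ∀ j, κmin ≤ κ j) (hρhalf : ∀ j, ρ j ≤ 1 / 2)
    (hϑ0 : 0 < ϑ) (hϑ1 : ϑ < 1) (hrate : ∀ j, ρ j ≤ c₁ * ϑ ^ j) :
    ∃ a : ℕ → ℕ → ℝ, (∀ K j, a K j ∈ Icc ((1 - κ j) * θ j) (θ j)) ∧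
      ShellWeightBound l₀ T (fun K t τ => histWeight (νA K (a K) t τ) (small K τ) (uA K) (fun s => a K (lvl K s)))
        (fun K t τ => histWeight (νB K (a K) t τ) (small K τ) (uB K) (fun s => a K (lvl K s)))
        (fun K t τ => histShell (νA K (a K) t τ) (small K τ) (uA K) (uB K) (fun s => a K (lvl K s)))
        (fun K t τ => histShell (νB K (a K) t τ) (small K τ) (uB K) (uA K) (fun s => a K (lvl K s)))
        fun K => (2 * ((N₁ + 1) * νbar * (Real.exp l₀ / (Real.exp l₀)⁻¹ * (2 * (2 * νbar) / κmin)) * c₁ * ϑ⁻¹ ^ N₁)) * ϑ ^ K := by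
  have hβ : ∀ K, 0 ≤ (D.scheme g₀).β K := fun _ => sq_nonneg _
  have hm : ∀ K C, Measurable ((D.scheme g₀).obs K C) := fun K C => D.measurable_avgObs hM K C
  have h1 : ∀ K C U, |(D.scheme g₀).obs K C U| ≤ 1 := fun K C U => D.abs_avgObs_le_one K C U
  haveI hfinA : ∀ K, IsFiniteMeasure (((fieldMeasure ((D.scheme g₀).P (K₀ + K)) 0 G).withDensity
      (fun U => ENNReal.ofReal (boltzmann ((D.scheme g₀).P (K₀ + K)) ((D.scheme g₀).β (K₀ + K)) U))).map (eA K)) := fun K => by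
    haveI := isFiniteMeasure_boltzmannLaw (D.scheme g₀) (K₀ + K) hβ
    exact Measure.isFiniteMeasure_map _ _
  haveI hfinB : ∀ K, IsFiniteMeasure (((fieldMeasure ((D.scheme g₀).P (K₀ + K + 1)) 0 G).withDensity
      (fun U => ENNReal.ofReal (boltzmann ((D.scheme g₀).P (K₀ + K + 1)) ((D.scheme g₀).β (K₀ + K + 1)) U))).map (eB K)) := fun K => by
    haveI := isFiniteMeasure_boltzmannLaw (D.scheme g₀) (K₀ + K + 1) hβ
    exact Measure.isFiniteMeasure_map _ _
  exact shellWeightBound_histories_of_resummation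
    (γ0A := fun K => ((fieldMeasure ((D.scheme g₀).P (K₀ + K)) 0 G).withDensity
      (fun U => ENNReal.ofReal (boltzmann ((D.scheme g₀).P (K₀ + K)) ((D.scheme g₀).β (K₀ + K)) U))).map (eA K))
    (γ0B := fun K => ((fieldMeasure ((D.scheme g₀).P (K₀ + K + 1)) 0 G).withDensity
      (fun U => ENNReal.ofReal (boltzmann ((D.scheme g₀).P (K₀ + K + 1)) ((D.scheme g₀).β (K₀ + K + 1)) U))).map (eB K))
    (γtA := fun K t => ((fieldMeasure ((D.scheme g₀).P (K₀ + K)) 0 G).withDensity (fun U => ENNReal.ofReal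
      (Real.exp (t * prodObs (D.scheme g₀) (K₀ + K) os U) * boltzmann ((D.scheme g₀).P (K₀ + K)) ((D.scheme g₀).β (K₀ + K)) U))).map (eA K))
    (γtB := fun K t => ((fieldMeasure ((D.scheme g₀).P (K₀ + K + 1)) 0 G).withDensity (fun U => ENNReal.ofReal
      (Real.exp (t * prodObs (D.scheme g₀) (K₀ + K + 1) os U) * boltzmann ((D.scheme g₀).P (K₀ + K + 1)) ((D.scheme g₀).β (K₀ + K + 1)) U))).map (eB K))
    (M := Real.exp l₀)
    huA huB hsmall hθ hκ hρ hwin (Real.exp_pos l₀) hΔ hcloseA hcloseB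
    (fun K t ht => dressedLaw_sandwich_map (D.scheme g₀) (K₀ + K) os hm h1 ht (heA K))
    (fun K t ht => dressedLaw_sandwich_map (D.scheme g₀) (K₀ + K + 1) os hm h1 ht (heB K))
    hresA hresB hκmin hκminle hρhalf hϑ0 hϑ1 hrate

end Junction

end Summit.QuantumFields.YangMills.Theorems.N21SourceTiltAtRecordLedgers

end
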